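/-
Copyright: the b2b-balaban T⁴-continuum CRUX team, row NE7b leaf lineage `t4-ne7b-formalise-leaf-05` (gen 153). Project licence.
-/
import Literature.MathematicalPhysics.QuantumFieldTheory.Balaban1983to89.B9SectEKernel

/-!
# THE CEILING `γ₁` OF `C*Δ_kC` (Theorem E2) AND THE TWO-SIDED COVARIANCE LETTERS OF `C̃^{(k)}(Λ) = (C*Δ_kC)⁻¹`, AS SKELETONS OF NAMED LETTERS:
# `⟨B, PB⟩ ≤ β⁻¹‖B‖²` from coercivity `β` of `N = QG₁Qᵀ` read INVERSE-FREE (`NP = 1`), `Δ_k = P − a − 𝒥 ≤ β⁻¹ + θ`, `C*Δ_kC ≤ (β⁻¹ + θ)c_C`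
# (`B9SectEKernel.form_sandwich_le` BY NAME); and for a symmetric `T` with `γ₀ ≤ T ≤ γ₁` (`γ₀ > 0`): `γ₁⁻¹‖y‖² ≤ ⟨y, T⁻¹y⟩ ≤ γ₀⁻¹‖y‖²` — the road's
# `(hσ, hΓ)` for the fluctuation operator and `(B₀⁻¹…B₀)`-type letters for its covariance, in B9 Sect. E's matrix currency (row NE7b, node U5c;
# residual (R2′) family (2), letter (ℓ1) + the covariance ceiling; kernel lemmas + junctions)

Cell `pub-balaban`, sub-cell `t4`, spine estimate NE7b (`T4WeightBudget.RelWeightBound`; the cell's OWN estimate — NOT PRINTED in [Bałaban 1983–89],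
NOT PROVED).  Crux-route work under `Spine/NE7b/`; NOTHING of Bałaban's is asserted; no `def`; zero `sorry`; no `T4Continuum/Support` leaf (FREEZE (0)).
Import (hub olean present): `Literature.….Balaban1983to89.B9SectEKernel` (r1; `form_sandwich_le`; transitively `QGQInverse.Coercive`, `isUnit_of_coercive`,
`two_dot_sub_form_le_inv_form`, `B9Thm311.dot_sq_le`).

WHY.  SectE-interface-proof.md §6 THEOREM E2 (supplies G-B10-06 (i), the printed-nowhere UPPER bound `γ₁` of `C*Δ_kC` used by [B10] p. 272 and [B13] (2.7)):
«`⟨B, Δ_kB⟩ ≤ ⟨B^{ext}, PB^{ext}⟩ + θ_J‖B‖²`; `P = (QG₁Q*)⁻¹` with `QG₁Q*` coercive `β(d,L)` (r1-g3 T1′) ⟹ `⟨B^{ext}, PB^{ext}⟩ ≤ β⁻¹‖B‖²`; hence `Δ_k ≤ β⁻¹ + θ_J` and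
`C*Δ_kC ≤ γ₁ := (β⁻¹ + θ_J)c_C`».  `…SectEGammaZeroLetters` ∕ `…AdmissibleFloorIMS` ∕ `…CurlFormEnergyDomination` (this lineage, gen 153) skeletonise E1 (the FLOOR
`γ₀`); THIS FILE skeletonises E2 (the CEILING) and then the two-sided letters of the INVERSE — the covariance `C̃^{(k)}(Λ) = (C*Δ_kC)⁻¹` of (3.158) that the
fluctuation integral (3.155) actually integrates against — so that the road's Gaussian-fibre consumers (`…ConvexWindowSuppliers` `hσ ∕ hΓ`, BFF §5-type
covariance letters) read Sect. E's operator with BOTH constants named.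

WHAT IS PROVED ([folklore]; `QGQInverse.Coercive M γ := ∀ x, γ·(x ⬝ᵥ x) ≤ x ⬝ᵥ (M x)`):
* §1 INVERSE-FREE CEILING OF `P`: **`dot_le_inv_coercive`** (`N` β-coercive, `β > 0`, `N y = B` ⊢ `y ⬝ᵥ B ≤ β⁻¹‖B‖²` — Cauchy–Schwarz, no symmetry),
  **`form_P_le_of_coercive`** (`NP = 1` — the inverse-free reading of `P = (QG₁Qᵀ)⁻¹` — and `N` β-coercive ⊢ `⟨B, PB⟩ ≤ β⁻¹‖B‖²`).
* §2 THEOREM E2's SKELETON: **`form_deltaK_le`** (`0 ≤ a`, `|⟨B, 𝒥B⟩| ≤ θ‖B‖²` ⊢ `⟨B,(P − a − 𝒥)B⟩ ≤ (β⁻¹ + θ)‖B‖²`), **`form_CDeltaC_le`**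
  (`B9SectEKernel.form_sandwich_le` BY NAME: `‖Cv‖² ≤ c_C‖v‖²` ⊢ `⟨v, Cᵀ(P − a − 𝒥)Cv⟩ ≤ (β⁻¹ + θ)c_C‖v‖²`).
* §3 THE COVARIANCE's TWO-SIDED LETTERS: **`inv_form_le_of_coercive`** (`T` γ₀-coercive, `γ₀ > 0` ⊢ `⟨y, T⁻¹y⟩ ≤ γ₀⁻¹‖y‖²`), **`inv_form_ge_of_form_le`**
  (`T` symmetric, γ₀-coercive with `γ₀ > 0`, `⟨v,Tv⟩ ≤ γ₁‖v‖²` with `γ₁ > 0` ⊢ `γ₁⁻¹‖y‖² ≤ ⟨y, T⁻¹y⟩` — `QGQInverse.two_dot_sub_form_le_inv_form` with the test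
  vector `γ₁⁻¹y`), `inv_coercive_of_form_le` (the same as `QGQInverse.Coercive T⁻¹ γ₁⁻¹`), **`covariance_letters`** (both at once: `γ₀ ≤ T ≤ γ₁` ⟹
  `γ₁⁻¹ ≤ T⁻¹ ≤ γ₀⁻¹` as forms).
* §4 **`covariance_letters_CDeltaC`** — E1's floor (binder `γ₀`, e.g. `…SectEGammaZeroLetters`'s `c∕640`) and §2's ceiling for `T := Cᵀ(P − a − 𝒥)C` with
  `T` symmetric ⊢ `((β⁻¹ + θ)c_C)⁻¹‖y‖² ≤ ⟨y, T⁻¹y⟩ ≤ γ₀⁻¹‖y‖²`: the fluctuation covariance `C̃^{(k)}(Λ)` of (3.158) with both constants NAMED.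
* §5 toy: `T = 2·1` on `Fin 1`-free `Fin 2`: `γ₀ = γ₁ = 2`, `T⁻¹ = ½·1`, both letters attained (`example`).

NOT HERE (honest): `β` BY VALUE (r1-g3 T1′: `qgq_coercive_of_approx_right_inverse` needs the explicit approximate right inverse of the multiscale `Q` and
Thm 3.3∕3.12 inputs — written in `QGQ-inverse-proof.md`, not kernel-checked beyond its skeleton); `θ = θ_J` and `c_C` BY VALUE ((π6)(π7)(π10)); the
identification `NP = 1` with print's `(QG₁Q*)(QG₁Q*)⁻¹ = 1` is the dictionary's (CFF §5 `hessian_lower_of_deltaK` builds `P` from two invertibility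
letters); E3 (resolvent family) is ALREADY the kernel's `resolvent_decay_uniform`; (A3) ∕ (A1c); NC-NE7b-α UNRULED.  BY-NAME EFFECT ON THE WALL: NONE.
NE7b NOT PRINTED ∕ NOT PROVED; spine PROVED 0∕9; rung (B)+1 on ONE finite T⁴ — NOT infinite volume, NOT the mass gap, NOT Clay.
HONEST DEPENDENCY: continuum YM on T⁴ ⇐ BetaPertH ∧ nine spine estimates (0/9 proved); BetaPertH ⇐ (D1) ∧ (D4) ∧ CAP+tail; G-an2-4 gates asym, D1 and NE2/3/4.
-/

set_option autoImplicit false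

noncomputable section

open Matrix Finset
open Literature.MathematicalPhysics.QuantumFieldTheory.Balaban1983to89 (QGQInverse.Coercive)
open Literature.MathematicalPhysics.QuantumFieldTheory.Balaban1983to89.QGQInverse (isUnit_of_coercive two_dot_sub_form_le_inv_form)
open Literature.MathematicalPhysics.QuantumFieldTheory.Balaban1983to89.B9Thm311 (dot_sq_le)
open Literature.MathematicalPhysics.QuantumFieldTheory.Balaban1983to89.B9SectEKernel (form_sandwich_le)

namespace Summit.QuantumFields.BalabanUV.T4Continuum.NE7b.SectECovarianceLetters

variable {m : Type*} [Fintype m]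

/-! ## §1 The inverse-free ceiling of `P = (QG₁Qᵀ)⁻¹` from coercivity of `N = QG₁Qᵀ` -/

section Ceiling

/-- **CAUCHY–SCHWARZ CEILING**: `N` β-coercive with `β > 0` and `N y = B` ⊢ `y ⬝ᵥ B ≤ β⁻¹‖B‖²` (`β‖y‖² ≤ ⟨y, Ny⟩ = ⟨y, B⟩ ≤ ‖y‖‖B‖`).
No symmetry of `N` is used. [folklore] -/
theorem dot_le_inv_coercive (N : Matrix m m ℝ) {β : ℝ} (hβ : 0 < β) (hN : QGQInverse.Coercive N β)
    (y B : m → ℝ) (hy : N *ᵥ y = B) : y ⬝ᵥ B ≤ β⁻¹ * (B ⬝ᵥ B) := by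
  have hc : β * (y ⬝ᵥ y) ≤ y ⬝ᵥ B := by rw [← hy]; exact hN y
  have hyy : 0 ≤ y ⬝ᵥ y := Literature.LinearAlgebra.Matrix.dotProduct_self_nonneg_real y
  have hBB : 0 ≤ B ⬝ᵥ B := Literature.LinearAlgebra.Matrix.dotProduct_self_nonneg_real B
  have hcs : (y ⬝ᵥ B) ^ 2 ≤ (y ⬝ᵥ y) * (B ⬝ᵥ B) := dot_sq_le y B
  rw [← div_eq_inv_mul, le_div_iff₀ hβ]
  -- `(y⬝B)·β ≤ B⬝B`: if `y⬝B ≤ 0` trivial; else `β(y⬝B)² ≤ β‖y‖²‖B‖² ≤ (y⬝B)‖B‖²` and divide by `y⬝B > 0``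
  rcases le_or_gt (y ⬝ᵥ B) 0 with hneg | hpos
  · nlinarith
  · have h1 : β * (y ⬝ᵥ y) * (B ⬝ᵥ B) ≤ (y ⬝ᵥ B) * (B ⬝ᵥ B) := mul_le_mul_of_nonneg_right hc hBB
    have h2 : β * (y ⬝ᵥ B) ^ 2 ≤ β * ((y ⬝ᵥ y) * (B ⬝ᵥ B)) := mul_le_mul_of_nonneg_left hcs hβ.le
    nlinarith [mul_pos hpos hβ]

variable [DecidableEq m]

/-- **`⟨B, PB⟩ ≤ β⁻¹‖B‖²`** from `NP = 1` (the inverse-free reading of `P = (QG₁Qᵀ)⁻¹`, `N = QG₁Qᵀ`) and `N` β-coercive (`β > 0`): test `y := PB`,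
`Ny = B`. (SectE-interface-proof §6: «a coercive symmetric matrix has inverse `≤ β⁻¹` as a form» — symmetry not even needed.) [folklore] -/
theorem form_P_le_of_coercive (N P : Matrix m m ℝ) (hNP : N * P = 1) {β : ℝ} (hβ : 0 < β) (hN : QGQInverse.Coercive N β)
    (B : m → ℝ) : B ⬝ᵥ (P *ᵥ B) ≤ β⁻¹ * (B ⬝ᵥ B) := by
  have hy : N *ᵥ (P *ᵥ B) = B := by rw [Matrix.mulVec_mulVec, hNP, Matrix.one_mulVec]
  have h := dot_le_inv_coercive N hβ hN (P *ᵥ B) B hy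
  rwa [dotProduct_comm] at h

end Ceiling

/-! ## §2 Theorem E2's skeleton: `Δ_k = P − a − 𝒥 ≤ β⁻¹ + θ`, `C*Δ_kC ≤ (β⁻¹ + θ)c_C` -/

section E2

variable [DecidableEq m]

/-- **`Δ_k ≤ β⁻¹ + θ_J` ON EVERY FIELD**: `⟨B, PB⟩ ≤ β⁻¹‖B‖²` (§1), `0 ≤ a` (drop `−a‖B‖²`), `|⟨B, 𝒥B⟩| ≤ θ‖B‖²` ⊢ `⟨B,(P − a − 𝒥)B⟩ ≤ (β⁻¹ + θ)‖B‖²`.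
[folklore] -/
theorem form_deltaK_le (N P Jm : Matrix m m ℝ) (hNP : N * P = 1) {β a θ : ℝ} (hβ : 0 < β) (ha : 0 ≤ a)
    (hN : QGQInverse.Coercive N β) (hJ : ∀ B : m → ℝ, |B ⬝ᵥ (Jm *ᵥ B)| ≤ θ * (B ⬝ᵥ B)) (B : m → ℝ) :
    B ⬝ᵥ ((P - a • (1 : Matrix m m ℝ) - Jm) *ᵥ B) ≤ (β⁻¹ + θ) * (B ⬝ᵥ B) := by
  have hP := form_P_le_of_coercive N P hNP hβ hN B
  have hJB : -(θ * (B ⬝ᵥ B)) ≤ B ⬝ᵥ (Jm *ᵥ B) := by linarith [neg_abs_le (B ⬝ᵥ (Jm *ᵥ B)), hJ B]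
  have hBB : 0 ≤ B ⬝ᵥ B := Literature.LinearAlgebra.Matrix.dotProduct_self_nonneg_real B
  rw [Matrix.sub_mulVec, Matrix.sub_mulVec, dotProduct_sub, dotProduct_sub, Matrix.smul_mulVec, Matrix.one_mulVec,
    dotProduct_smul, smul_eq_mul]
  nlinarith

/-- **THEOREM E2's SKELETON — `C*Δ_kC ≤ γ₁ := (β⁻¹ + θ)c_C`** (`B9SectEKernel.form_sandwich_le` BY NAME): with `‖Cv‖² ≤ c_C‖v‖²` and `0 ≤ β⁻¹ + θ`,
`⟨v, Cᵀ(P − a − 𝒥)Cv⟩ ≤ (β⁻¹ + θ)c_C‖v‖²`. [folklore] -/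
theorem form_CDeltaC_le {p : Type*} [Fintype p] (N P Jm : Matrix m m ℝ) (hNP : N * P = 1) {β a θ cC : ℝ}
    (hβ : 0 < β) (ha : 0 ≤ a) (hθ : 0 ≤ β⁻¹ + θ)
    (hN : QGQInverse.Coercive N β) (hJ : ∀ B : m → ℝ, |B ⬝ᵥ (Jm *ᵥ B)| ≤ θ * (B ⬝ᵥ B))
    (C : Matrix m p ℝ) (hC : ∀ v : p → ℝ, (C *ᵥ v) ⬝ᵥ (C *ᵥ v) ≤ cC * (v ⬝ᵥ v)) (v : p → ℝ) :
    v ⬝ᵥ ((Cᵀ * (P - a • (1 : Matrix m m ℝ) - Jm) * C) *ᵥ v) ≤ (β⁻¹ + θ) * cC * (v ⬝ᵥ v) :=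
  form_sandwich_le (P - a • (1 : Matrix m m ℝ) - Jm) C hθ (form_deltaK_le N P Jm hNP hβ ha hN hJ) hC v

end E2

/-! ## §3 The covariance's two-sided letters: `γ₀ ≤ T ≤ γ₁` ⟹ `γ₁⁻¹ ≤ T⁻¹ ≤ γ₀⁻¹` -/

section Covariance

variable {n : Type*} [Fintype n] [DecidableEq n]

/-- **UPPER LETTER OF THE INVERSE**: `T` γ₀-coercive, `γ₀ > 0` ⊢ `⟨y, T⁻¹y⟩ ≤ γ₀⁻¹‖y‖²` (§1 with `N := T`, `x := T⁻¹y`; `T` is a unit by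
`QGQInverse.isUnit_of_coercive`). [folklore] -/
theorem inv_form_le_of_coercive (T : Matrix n n ℝ) {γ₀ : ℝ} (hγ₀ : 0 < γ₀) (hT : QGQInverse.Coercive T γ₀) (y : n → ℝ) :
    y ⬝ᵥ (T⁻¹ *ᵥ y) ≤ γ₀⁻¹ * (y ⬝ᵥ y) := by
  have hU : IsUnit T.det := (Matrix.isUnit_iff_isUnit_det T).mp (isUnit_of_coercive hγ₀ hT)
  have hy : T *ᵥ (T⁻¹ *ᵥ y) = y := by rw [Matrix.mulVec_mulVec, Matrix.mul_nonsing_inv T hU, Matrix.one_mulVec]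
  have h := dot_le_inv_coercive T hγ₀ hT (T⁻¹ *ᵥ y) y hy
  rwa [dotProduct_comm] at h

/-- **LOWER LETTER OF THE INVERSE**: `T` symmetric, γ₀-coercive with `γ₀ > 0` (so a unit with nonnegative form), `⟨v, Tv⟩ ≤ γ₁‖v‖²` with `γ₁ > 0`
⊢ `γ₁⁻¹‖y‖² ≤ ⟨y, T⁻¹y⟩` (`QGQInverse.two_dot_sub_form_le_inv_form` at the test vector `γ₁⁻¹y`: `2γ₁⁻¹‖y‖² − γ₁⁻²⟨y,Ty⟩ ≥ γ₁⁻¹‖y‖²`). [folklore] -/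
theorem inv_form_ge_of_form_le (T : Matrix n n ℝ) (hTs : T.IsSymm) {γ₀ γ₁ : ℝ} (hγ₀ : 0 < γ₀) (hγ₁ : 0 < γ₁)
    (hT : QGQInverse.Coercive T γ₀) (hT' : ∀ v : n → ℝ, v ⬝ᵥ (T *ᵥ v) ≤ γ₁ * (v ⬝ᵥ v)) (y : n → ℝ) :
    γ₁⁻¹ * (y ⬝ᵥ y) ≤ y ⬝ᵥ (T⁻¹ *ᵥ y) := by
  have hpos : ∀ v : n → ℝ, 0 ≤ v ⬝ᵥ (T *ᵥ v) := fun v =>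
    (mul_nonneg hγ₀.le (Literature.LinearAlgebra.Matrix.dotProduct_self_nonneg_real v)).trans (hT v)
  have h := two_dot_sub_form_le_inv_form T hTs (isUnit_of_coercive hγ₀ hT) hpos (γ₁⁻¹ • y) y
  simp only [smul_dotProduct, dotProduct_smul, Matrix.mulVec_smul, smul_eq_mul] at h
  have h2 := mul_le_mul_of_nonneg_left (hT' y) (by positivity : (0 : ℝ) ≤ γ₁⁻¹ * γ₁⁻¹)
  have e : γ₁⁻¹ * γ₁⁻¹ * (γ₁ * (y ⬝ᵥ y)) = γ₁⁻¹ * (y ⬝ᵥ y) := by field_simp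
  rw [e] at h2
  linarith

/-- … in coercivity currency: `QGQInverse.Coercive T⁻¹ γ₁⁻¹`. [folklore] -/
theorem inv_coercive_of_form_le (T : Matrix n n ℝ) (hTs : T.IsSymm) {γ₀ γ₁ : ℝ} (hγ₀ : 0 < γ₀) (hγ₁ : 0 < γ₁)
    (hT : QGQInverse.Coercive T γ₀) (hT' : ∀ v : n → ℝ, v ⬝ᵥ (T *ᵥ v) ≤ γ₁ * (v ⬝ᵥ v)) :
    QGQInverse.Coercive T⁻¹ γ₁⁻¹ :=
  fun y => inv_form_ge_of_form_le T hTs hγ₀ hγ₁ hT hT' y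

/-- **THE COVARIANCE's TWO-SIDED LETTERS**: `T` symmetric with `γ₀‖v‖² ≤ ⟨v,Tv⟩ ≤ γ₁‖v‖²` (`0 < γ₀`, `0 < γ₁`) ⊢ for every `y`,
`γ₁⁻¹‖y‖² ≤ ⟨y, T⁻¹y⟩ ≤ γ₀⁻¹‖y‖²`. [folklore] -/
theorem covariance_letters (T : Matrix n n ℝ) (hTs : T.IsSymm) {γ₀ γ₁ : ℝ} (hγ₀ : 0 < γ₀) (hγ₁ : 0 < γ₁)
    (hT : QGQInverse.Coercive T γ₀) (hT' : ∀ v : n → ℝ, v ⬝ᵥ (T *ᵥ v) ≤ γ₁ * (v ⬝ᵥ v)) (y : n → ℝ) :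
    γ₁⁻¹ * (y ⬝ᵥ y) ≤ y ⬝ᵥ (T⁻¹ *ᵥ y) ∧ y ⬝ᵥ (T⁻¹ *ᵥ y) ≤ γ₀⁻¹ * (y ⬝ᵥ y) :=
  ⟨inv_form_ge_of_form_le T hTs hγ₀ hγ₁ hT hT' y, inv_form_le_of_coercive T hγ₀ hT y⟩

end Covariance

/-! ## §4 `C̃^{(k)}(Λ) = (C*Δ_kC)⁻¹` with both constants named -/

section CDeltaC

variable [DecidableEq m]

/-- **THE FLUCTUATION COVARIANCE OF (3.158) WITH BOTH CONSTANTS NAMED**: for `T := Cᵀ(P − a•1 − 𝒥)C` symmetric, E1's floor `QGQInverse.Coercive T γ₀`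
(`γ₀ > 0`; e.g. `…SectEGammaZeroLetters.coercive_CDeltaC_of_letters`' `c∕640`) and E2's letters (`NP = 1`, `N` β-coercive, `0 ≤ a`, `|⟨B,𝒥B⟩| ≤ θ‖B‖²`,
`‖Cv‖² ≤ c_C‖v‖²`, `0 < (β⁻¹ + θ)c_C`) ⊢ `((β⁻¹ + θ)c_C)⁻¹‖y‖² ≤ ⟨y, T⁻¹y⟩ ≤ γ₀⁻¹‖y‖²`. [folklore] -/
theorem covariance_letters_CDeltaC {p : Type*} [Fintype p] [DecidableEq p] (N P Jm : Matrix m m ℝ) (hNP : N * P = 1)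
    {β a θ cC γ₀ : ℝ} (hβ : 0 < β) (ha : 0 ≤ a) (hθ : 0 ≤ β⁻¹ + θ) (hγ₁ : 0 < (β⁻¹ + θ) * cC) (hγ₀ : 0 < γ₀)
    (hN : QGQInverse.Coercive N β) (hJ : ∀ B : m → ℝ, |B ⬝ᵥ (Jm *ᵥ B)| ≤ θ * (B ⬝ᵥ B))
    (C : Matrix m p ℝ) (hC : ∀ v : p → ℝ, (C *ᵥ v) ⬝ᵥ (C *ᵥ v) ≤ cC * (v ⬝ᵥ v))
    (hTs : (Cᵀ * (P - a • (1 : Matrix m m ℝ) - Jm) * C).IsSymm)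
    (hfloor : QGQInverse.Coercive (Cᵀ * (P - a • (1 : Matrix m m ℝ) - Jm) * C) γ₀) (y : p → ℝ) :
    ((β⁻¹ + θ) * cC)⁻¹ * (y ⬝ᵥ y) ≤ y ⬝ᵥ ((Cᵀ * (P - a • (1 : Matrix m m ℝ) - Jm) * C)⁻¹ *ᵥ y) ∧
      y ⬝ᵥ ((Cᵀ * (P - a • (1 : Matrix m m ℝ) - Jm) * C)⁻¹ *ᵥ y) ≤ γ₀⁻¹ * (y ⬝ᵥ y) :=
  covariance_letters _ hTs hγ₀ hγ₁ hfloor (form_CDeltaC_le N P Jm hNP hβ ha hθ hN hJ C hC) y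

end CDeltaC

/-! ## §5 Toy: `T = 2·1` — both letters attained -/

section Toy

/- `T = 2•1` on `Fin 2`: `γ₀ = γ₁ = 2`, so `½‖y‖² ≤ ⟨y, T⁻¹y⟩ ≤ ½‖y‖²`. -/
example (y : Fin 2 → ℝ) :
    (2 : ℝ)⁻¹ * (y ⬝ᵥ y) ≤ y ⬝ᵥ (((2 : ℝ) • (1 : Matrix (Fin 2) (Fin 2) ℝ))⁻¹ *ᵥ y) ∧
      y ⬝ᵥ (((2 : ℝ) • (1 : Matrix (Fin 2) (Fin 2) ℝ))⁻¹ *ᵥ y) ≤ (2 : ℝ)⁻¹ * (y ⬝ᵥ y) :=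
  covariance_letters ((2 : ℝ) • (1 : Matrix (Fin 2) (Fin 2) ℝ)) (Matrix.isSymm_one.smul 2) two_pos two_pos
    (fun v => by rw [Matrix.smul_mulVec, Matrix.one_mulVec, dotProduct_smul, smul_eq_mul])
    (fun v => by rw [Matrix.smul_mulVec, Matrix.one_mulVec, dotProduct_smul, smul_eq_mul]) y

end Toy

end Summit.QuantumFields.BalabanUV.T4Continuum.NE7b.SectECovarianceLetters

end
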